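import Summits.AtomisticToContinuum.Crystallization.Theorems.PalmUnimodularRigidityLayeredLawsSelectHcpSelectionWord
import Summits.AtomisticToContinuum.Crystallization.Theorems.LayeredLawsSelectHcp.Negative.RootedRedundant
import Summits.AtomisticToContinuum.Crystallization.Theorems.LayeredLawsSelectHcp.Negative.FccModel
import Summits.AtomisticToContinuum.Crystallization.Theorems.LayeredLawsSelectHcp.Negative.IntendedModel
import Summits.AtomisticToContinuum.Crystallization.Theorems.PalmUnimodularRigidityCruxesToPalmRigidity
import Literature.Probability.Process.PointStationaryLaw

/-!
# Hägg selection (stub `stub_haggSelection` of line `mtp-prestress-split-ergodic-frame`, crux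
# `LayeredLawsSelectHcp`, stmt-AtomisticToContinuum-9226), potential-free back end, II:
# Palm transfer and the null-cubic-root stub

Part I (`…SelectionWord`) read the site type of a Barlow-like configuration off its Hägg word and showed
that an all-hexagonal Barlow-like configuration is hcp-charted (`stub_haggSelection_hexWord`). Here:

* `isHexSite_image_iff`, `isCubicSite_image_sub_zero_iff` — the site predicates are intrinsic: carried by
  isometries, in particular TRANSLATION-COVARIANT (the root of the configuration re-rooted at `y` is cubic
  iff `y` is a cubic site); `pts_count_restrict`;
* consistency of the split with the Disproof (`Cruxes/LayeredLawsSelectHcp/Disproof.lean`): every site of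
  ideal hcp is hexagonal and the intended model's Palm law does not charge `cubicRoot`
  (`isHexSite_hcpStacking_ideal`, `hcpPalm_cubicRoot` — the hypothesis of the null-cubic-root stub holds on
  the intended witness), every site of fcc is cubic and `fccLaw a cubicRoot = 1` (`fccLaw_cubicRoot`), so
  the ENERGETIC sub-goal minus H3 is false (`cubicRootNull_false_without_energy`, the localisation of
  `layeredLawsSelectHcp_false_without_energy` to the split);
* **`stub_haggSelection_aeHexSites`** (registered sub-goal; the Palm transfer): under a point-stationary
  layered law with `P cubicRoot = 0`, a.s. EVERY atom is a hexagonal site — the landed Aldous–Lyons lemma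
  `PalmUnimodularRigidity.ae_forall_map_sub_of_ae` ("root a.s. ⇒ every point a.s.", no measurability of
  the event needed; local finiteness from the `891/1000` hard core of layered laws,
  `rooted_of_pointStationary_layered` + `count_restrict_floorNorm_preimage_lt_top`) and the shift of
  counting measures `map_sub_count_restrict`;
* **`stub_haggSelection_nullCubicRoot`** (registered sub-goal; = `stub_nullCubicRootGivesHcpWord` of the
  sibling skeleton `Lines/stress_jump_young_hagg_density.lean`): a point-stationary layered probability
  law that does not charge `cubicRoot` is hcp-layered (`HcpLayered`).

So `stub_haggSelection` is reduced to its ENERGETIC front end, registered as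
`stub_haggSelection_cubicRootNull : … → meanRootEnergy P ≤ eStar → Layered P → P cubicRoot = 0`
(fault density zero for minimising laws; needs the certified couplings of item 3063). All `[folklore]`.
-/

noncomputable section

namespace Summit.AtomisticToContinuum.Crystallization.Theorems.PalmUnimodularRigidity.LayeredLawsSelectHcp

open MeasureTheory Set
open Literature.MathematicalPhysics.StatisticalMechanics Literature.Geometry.DiscreteGeometry
open Literature.Probability.Process (map_sub_count_restrict count_restrict_singleton_ne_zero_iff)
open Summit.AtomisticToContinuum.Crystallization.Theorems.LayeredLawsSelectHcp.Negative.DiracLaws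
  (PointStationary GoodShell BarlowLike Layered)
open Summit.AtomisticToContinuum.Crystallization.Theorems.LayeredLawsSelectHcp.Negative.RootedRedundant
  (rooted_of_pointStationary_layered)
open Summit.AtomisticToContinuum.Crystallization.Theorems.LayeredLawsSelectHcp.Negative

/-- Euclidean `3`-space. [folklore] -/
local notation "E3" => EuclideanSpace ℝ (Fin 3)

/-! ## Bonds and site types are invariant under isometries (translation covariance) -/

/-- Bonds are carried by isometries. [folklore] -/
theorem bond_image_iff {f : E3 → E3} (hf : Isometry f) (S : Set E3) (u v : E3) :
    Bond (f '' S) (f u) (f v) ↔ Bond S u v := by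
  simp only [Bond, hf.injective.mem_set_image, hf.dist_eq]

/-- Hexagonal sites are carried by isometries. [folklore] -/
theorem isHexSite_image_iff {f : E3 → E3} (hf : Isometry f) (S : Set E3) (x : E3) :
    IsHexSite (f '' S) (f x) ↔ IsHexSite S x := by
  constructor
  · rintro ⟨p, q, t, b, htb, hxp, hxq, hxt, hxb, hpq, htp, htq, hbp, hbq⟩
    obtain ⟨p, -, rfl⟩ := hxp.2.1
    obtain ⟨q, -, rfl⟩ := hxq.2.1
    obtain ⟨t, -, rfl⟩ := hxt.2.1
    obtain ⟨b, -, rfl⟩ := hxb.2.1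
    rw [bond_image_iff hf] at hxp hxq hxt hxb hpq htp htq hbp hbq
    exact ⟨p, q, t, b, fun h => htb (congrArg f h), hxp, hxq, hxt, hxb, hpq, htp, htq, hbp, hbq⟩
  · rintro ⟨p, q, t, b, htb, hxp, hxq, hxt, hxb, hpq, htp, htq, hbp, hbq⟩
    refine ⟨f p, f q, f t, f b, fun h => htb (hf.injective h), ?_⟩
    simp only [bond_image_iff hf]
    exact ⟨hxp, hxq, hxt, hxb, hpq, htp, htq, hbp, hbq⟩

/-- Cubic sites are carried by isometries. [folklore] -/
theorem isCubicSite_image_iff {f : E3 → E3} (hf : Isometry f) (S : Set E3) (x : E3) :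
    IsCubicSite (f '' S) (f x) ↔ IsCubicSite S x := by
  rw [IsCubicSite, IsCubicSite, isHexSite_image_iff hf, hf.injective.mem_set_image]

/-- **Translation covariance of the cubic-site predicate**: the root of the configuration re-rooted
at `y` is cubic iff `y` is a cubic site. [folklore] -/
theorem isCubicSite_image_sub_zero_iff (S : Set E3) (y : E3) :
    IsCubicSite ((fun z : E3 => z - y) '' S) 0 ↔ IsCubicSite S y := by
  have h := isCubicSite_image_iff (Isometry.of_dist_eq fun a b : E3 => dist_sub_right a b y) S y
  rwa [sub_self] at h

/-- The atoms of a counting measure are its carrier. [folklore] -/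
theorem pts_count_restrict (S : Set E3) : pts ((Measure.count : Measure E3).restrict S) = S :=
  Set.ext fun y => count_restrict_singleton_ne_zero_iff S y

/-! ## Consistency of the split with the Disproof: fcc charges `cubicRoot`, ideal hcp does not -/

section Consistency

variable {a : ℝ} {s : ℤ → ℤ}

/-- The explicit chart of an ideal stacking of spacing `a ∈ [9/10, 1]`: the scaling `z ↦ a • z` from the
unit ideal stacking of the same word (the data inside `IdealStackings.barlowLike_barlowStacking_ideal`,
exposed). [folklore] -/
theorem chart_ideal_smul (hs : IsHaggSeq s) (h9 : 9 / 10 ≤ a) (h1 : a ≤ 1) :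
    Set.BijOn (fun z : E3 => a • z) (barlowStacking 1 (Real.sqrt (2 / 3)) s)
        (barlowStacking a (a * Real.sqrt (2 / 3)) s) ∧
      ∀ p ∈ barlowStacking 1 (Real.sqrt (2 / 3)) s, ∀ q ∈ barlowStacking 1 (Real.sqrt (2 / 3)) s,
        (dist p q = 1 ↔ (0 < dist (a • p) (a • q) ∧ dist (a • p) (a • q) ≤ 28 / 25)) := by
  have ha : 0 < a := by linarith
  have hη : (Real.sqrt (2 / 3)) ^ 2 = 2 / 3 * 1 ^ 2 := by rw [Real.sq_sqrt (by norm_num)]; ring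
  refine ⟨?_, ?_⟩
  · have himg : (fun z : E3 => a • z) '' barlowStacking 1 (Real.sqrt (2 / 3)) s =
        barlowStacking a (a * Real.sqrt (2 / 3)) s := by
      ext z
      simp only [Set.mem_image, mem_barlowStacking_iff]
      constructor
      · rintro ⟨_, ⟨k, i, j, rfl⟩, rfl⟩
        exact ⟨k, i, j, IdealStackings.barlowPos_smul a _ s k i j⟩
      · rintro ⟨k, i, j, rfl⟩
        exact ⟨_, ⟨k, i, j, rfl⟩, IdealStackings.barlowPos_smul a _ s k i j⟩
    rw [← himg]
    exact Set.InjOn.bijOn_image (smul_right_injective E3 ha.ne').injOn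
  · rintro _ ⟨k, i, j, rfl⟩ _ ⟨k', i', j', rfl⟩
    rw [dist_smul₀, Real.norm_of_nonneg ha.le]
    set d := dist (barlowPos 1 (Real.sqrt (2 / 3)) s k i j) (barlowPos 1 (Real.sqrt (2 / 3)) s k' i' j')
      with hddef
    constructor
    · intro hd1
      rw [hd1, mul_one]
      exact ⟨ha, by linarith⟩
    · rintro ⟨hpos, hle⟩
      have hne : (k, i, j) ≠ (k', i', j') := by
        rintro heq
        simp only [Prod.mk.injEq] at heq
        obtain ⟨rfl, rfl, rfl⟩ := heq
        rw [hddef, dist_self, mul_zero] at hpos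
        exact lt_irrefl 0 hpos
      have hle' : d ≤ 5 / 4 * 1 := by
        have h2 : a * d ≤ a * (5 / 4) := by nlinarith
        have := le_of_mul_le_mul_left h2 ha
        linarith
      exact IdealStackings.dist_eq_of_le_of_ideal hs one_pos hη hne hle'

/-- **Every site of the ideal hcp stacking is hexagonal** (`a ∈ [9/10, 1]`): the letters of
`alternatingHagg` alternate. [folklore] -/
theorem isHexSite_hcpStacking_ideal (h9 : 9 / 10 ≤ a) (h1 : a ≤ 1) (k i j : ℤ) :
    IsHexSite (hcpStacking a (a * Real.sqrt (2 / 3)))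
      (barlowPos a (a * Real.sqrt (2 / 3)) alternatingHagg k i j) := by
  obtain ⟨hbij, hiso⟩ := chart_ideal_smul isHaggSeq_alternating h9 h1
  rw [← IdealStackings.barlowPos_smul]
  exact (isHexSite_chart_iff isHaggSeq_alternating hbij hiso k i j).2
    (by rw [alternatingHagg_sub_one, neg_neg])

/-- **The intended model does not charge `cubicRoot`**: under the Palm law of ideal hcp (views from the
`A`- and the `B`-site) the root is a.s. a hexagonal site — the hypothesis `P cubicRoot = 0` of
`stub_haggSelection_nullCubicRoot` holds on the crux's intended witness (`Negative.IntendedModel`).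
[folklore] -/
theorem hcpPalm_cubicRoot (h9 : 9 / 10 ≤ a) (h1 : a ≤ 1) :
    PeriodicPalmLaw.palmLaw (IntendedModel.hcpQ (show a ≠ 0 by intro h; rw [h] at h9; norm_num at h9))
      cubicRoot = 0 := by
  have ha : 0 < a := by linarith
  set Q := IntendedModel.hcpQ (show a ≠ 0 by intro h; rw [h] at h9; norm_num at h9) with hQ
  have hpts : Q.points = barlowStacking a (a * Real.sqrt (2 / 3)) alternatingHagg :=
    IntendedModel.hcpQ_points ha.ne'
  refine measure_eq_zero_iff_ae_notMem.2 (PeriodicPalmLaw.ae_palmLaw Q fun x hx => ?_)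
  change ¬ IsCubicSite (pts ((Measure.count : Measure E3).restrict
    ((fun p : E3 => p - x) '' Q.points))) 0
  rw [pts_count_restrict, isCubicSite_image_sub_zero_iff, hpts]
  rintro ⟨-, hnot⟩
  rcases IntendedModel.mem_hcpQ_motif ha.ne' hx with rfl | rfl
  · have h := isHexSite_hcpStacking_ideal h9 h1 0 0 0
    have h0 : barlowPos a (a * Real.sqrt (2 / 3)) alternatingHagg 0 0 0 = 0 := by
      ext l; fin_cases l <;> simp
    rw [h0] at h
    exact hnot h
  · exact hnot (isHexSite_hcpStacking_ideal h9 h1 1 0 0)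

/-- In a Barlow-like configuration charted by a word with two EQUAL consecutive letters at every layer
(the fcc word `constHagg`), every point is a cubic site. [folklore] -/
theorem isCubicSite_of_chart_const {S : Set E3} {Φ : E3 → E3} (hs : IsHaggSeq s)
    (hbij : Set.BijOn Φ (barlowStacking 1 (Real.sqrt (2 / 3)) s) S)
    (hiso : ∀ p ∈ barlowStacking 1 (Real.sqrt (2 / 3)) s, ∀ q ∈ barlowStacking 1 (Real.sqrt (2 / 3)) s,
      (dist p q = 1 ↔ (0 < dist (Φ p) (Φ q) ∧ dist (Φ p) (Φ q) ≤ 28 / 25)))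
    (hconst : ∀ k, s k = s (k - 1)) {x : E3} (hx : x ∈ S) : IsCubicSite S x := by
  refine ⟨hx, fun hhex => ?_⟩
  obtain ⟨p, hp, rfl⟩ := hbij.surjOn hx
  obtain ⟨k, i, j, rfl⟩ := hp
  have h := (isHexSite_chart_iff hs hbij hiso k i j).1 hhex
  rw [hconst k] at h
  rcases hs (k - 1) with h1 | h1 <;> omega

/-- **The fcc Palm law charges `cubicRoot` fully** (`9/10 ≤ a ≤ 1`): every site of the fcc lattice is cubic
(chart word `constHagg`, `FccLattice.bijOn_cubicMap` / `bond_iff_cubicMap`). [folklore] -/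
theorem fccLaw_cubicRoot (h9 : 9 / 10 ≤ a) (h1 : a ≤ 1) : FccModel.fccLaw a cubicRoot = 1 := by
  have hη : (Real.sqrt (2 / 3)) ^ 2 = 2 / 3 := Real.sq_sqrt (by norm_num)
  have hcubic : IsCubicSite (FccLattice.fccD3 a : Set E3) 0 :=
    isCubicSite_of_chart_const isHaggSeq_const (FccLattice.bijOn_cubicMap hη (by linarith))
      (fun p hp q hq => FccLattice.bond_iff_cubicMap hη h9 h1 hp hq) (fun _ => rfl)
      (FccLattice.fccD3 a).zero_mem
  refine Measure.dirac_apply_of_mem ?_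
  change IsCubicSite (pts ((Measure.count : Measure E3).restrict (FccLattice.fccD3 a : Set E3))) 0
  rwa [pts_count_restrict]

/-- **The energetic sub-goal is load-bearing** (Disproof obligation `layeredLawsSelectHcp_false_without_energy`,
localised to the split `stub_haggSelection = stub_haggSelection_nullCubicRoot ∘ stub_haggSelection_cubicRootNull`):
WITHOUT the minimality hypothesis `meanRootEnergy P ≤ e*`, "point-stationary layered probability laws do not
charge `cubicRoot`" is FALSE — witness the fcc Palm law (`fccLaw_cubicRoot`). [folklore] -/
theorem cubicRootNull_false_without_energy :
    ¬ ∀ P : Measure (Measure E3), IsProbabilityMeasure P → PointStationary P → Layered P →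
      P cubicRoot = 0 := by
  intro h
  have h1 := h (FccModel.fccLaw 1) inferInstance (FccModel.pointStationary_fccLaw 1)
    (FccModel.layered_fccLaw (by norm_num) le_rfl)
  rw [fccLaw_cubicRoot (by norm_num) le_rfl] at h1
  exact one_ne_zero h1

end Consistency

/-! ## Palm transfer: root a.s. not cubic ⇒ a.s. no cubic site -/

/-- Layered point-stationary laws are a.s. locally finite (finite mass on every norm shell): the
`891/1000` hard core of good shells (`rooted_of_pointStationary_layered`). [folklore] -/
theorem ae_locallyFinite_of_layered {P : Measure (Measure E3)} (hstat : PointStationary P)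
    (hlay : Layered P) : ∀ᵐ μ ∂P, ∀ n : ℕ, μ ((fun z : E3 => ⌊‖z‖⌋₊) ⁻¹' {n}) < ⊤ := by
  filter_upwards [rooted_of_pointStationary_layered hstat hlay] with μ ⟨S, _, hsep, hμS⟩
  intro n
  rw [hμS]
  exact PalmUnimodularRigidity.count_restrict_floorNorm_preimage_lt_top
    (by norm_num : (0 : ℝ) < 891 / 1000) hsep n

/-- **Registered sub-goal `stub_haggSelection_aeHexSites` of `stub_haggSelection` (Palm transfer): under
a point-stationary layered law that does not charge `cubicRoot`, almost surely EVERY atom is a hexagonal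
site.** Aldous–Lyons "everything shows at the root" (`PalmUnimodularRigidity.ae_forall_map_sub_of_ae`,
no measurability of the event needed) with the property "the root is not cubic", then translation
covariance (`map_sub_count_restrict`, `isCubicSite_image_sub_zero_iff`). [folklore] -/
theorem stub_haggSelection_aeHexSites :
    ∀ P : Measure (Measure E3), PointStationary P → Layered P → P cubicRoot = 0 →
      ∀ᵐ μ ∂P, ∀ y ∈ pts μ, IsHexSite (pts μ) y := by
  intro P hstat hlay h0
  have hroot : ∀ᵐ μ ∂P, μ ∉ cubicRoot := measure_eq_zero_iff_ae_notMem.1 h0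
  have key := PalmUnimodularRigidity.ae_forall_map_sub_of_ae hstat
    (ae_locallyFinite_of_layered hstat hlay) hroot
  filter_upwards [key, hlay] with μ hμ ⟨S, hμS, _, _⟩
  intro y hy
  have h1 : Measure.map (fun z : E3 => z - y) μ ∉ cubicRoot := hμ y hy
  rw [hμS, pts_count_restrict] at hy ⊢
  rw [hμS, map_sub_count_restrict] at h1
  change ¬ IsCubicSite (pts ((Measure.count : Measure E3).restrict ((fun z : E3 => z - y) '' S))) 0
    at h1
  rw [pts_count_restrict, isCubicSite_image_sub_zero_iff] at h1
  by_contra hhex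
  exact h1 ⟨hy, hhex⟩

/-! ## The null-cubic-root stub -/

/-- **Registered sub-goal `stub_haggSelection_nullCubicRoot` of `stub_haggSelection` — the whole
POTENTIAL-FREE back end of the selection half (= `stub_nullCubicRootGivesHcpWord` of the sibling
skeleton `Lines/stress_jump_young_hagg_density.lean`): a point-stationary layered probability law that
does not charge the event "the root is a cubic site" is hcp-layered.** Palm transfer
(`stub_haggSelection_aeHexSites`) makes every atom hexagonal a.s.; the word combinatorics
(`stub_haggSelection_hexWord`) turns the Barlow chart into an hcp chart. What remains of
`stub_haggSelection` after this is the ENERGETIC statement `P cubicRoot = 0` for minimising laws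
(registered as `stub_haggSelection_cubicRootNull`). [folklore] -/
theorem stub_haggSelection_nullCubicRoot :
    ∀ P : Measure (Measure E3), IsProbabilityMeasure P → PointStationary P → Layered P →
      P cubicRoot = 0 → HcpLayered P := by
  intro P _ hstat hlay h0
  filter_upwards [hlay, stub_haggSelection_aeHexSites P hstat hlay h0] with μ ⟨S, hμS, hgood, hbar⟩ hhex
  refine ⟨S, hμS, hgood, stub_haggSelection_hexWord S hbar ?_⟩
  rw [hμS, pts_count_restrict] at hhex
  exact hhex

end Summit.AtomisticToContinuum.Crystallization.Theorems.PalmUnimodularRigidity.LayeredLawsSelectHcp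

end
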